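import Mathlib
import Literature.AlgebraicGeometry.Resolution.CurveBlowupDeltaDrop
import Literature.AlgebraicGeometry.Resolution.FiniteNormalizationGRing
import Literature.AlgebraicGeometry.Resolution.Temkin2008OfHironaka
import Literature.AlgebraicGeometry.Resolution.Temkin2008Localization
import Literature.AlgebraicGeometry.Resolution.RegularLocusDense
import Literature.AlgebraicGeometry.Resolution.AlterationsCurves
import Literature.AlgebraicGeometry.Resolution.CompleteLocalDomainNormalization
import HarnessLib

/-!
# The `δ`-hypotheses hold for quasi-excellent curves

Topic: `Literature/AlgebraicGeometry/Resolution`. The hypotheses of the `δ`-drop theorems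
(`BlowupPointDeltaDrop.lean`, `CurveBlowupDeltaDrop.lean`) — finite normalization of the local
rings, `δ < ∞`, finiteness of the support of `δ` — hold for every integral Noetherian
quasi-excellent scheme `C` of dimension `≤ 1` (the curves `C ⊆ X(i)` of a Cossart–Piltant stage
are of this kind: closed subschemes of quasi-excellent schemes are quasi-excellent,
`Scheme.IsQuasiExcellent.of_isClosedImmersion`). All PROVED from the tree:

* `ringKrullDim_stalk_le_one`, `isField_or_ringKrullDim_eq_one` — the local rings of `C` are
  fields (maximal point) or of dimension one;
* `module_finite_integralClosure_stalk` — **finite normalization of every `𝒪_{C,y}`**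
  (quasi-excellent ⇒ G-ring ⇒ analytically unramified, Krull–Kollár 1.101;
  `module_finite_integralClosure_of_isGRing_of_ringKrullDim_eq_one`);
* `pointDelta_ne_top`, `pointDelta_eq_zero_of_isRegularLocalRing` — `δ(y) < ∞`, and `δ(y) = 0`
  at regular points (a one-dimensional regular local ring is a discrete valuation ring);
* `finite_support_pointDelta` — **the support of `δ` is finite**: it lies in the singular locus,
  a proper (the generic point is regular) closed (J-2) subset of a one-dimensional irreducible
  Noetherian space.

## Sources

* J. Kollár, *Lectures on Resolution of Singularities* (2007), §1.4 and Thm. 1.101. [Kollar2007]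
* H. Matsumura, *Commutative Ring Theory* (1986), §32 (quasi-excellent rings). [Matsumura1987]
-/

noncomputable section

open CategoryTheory AlgebraicGeometry TopologicalSpace IsLocalRing

namespace Literature.AlgebraicGeometry.Resolution

universe u

variable {C : Scheme.{u}} [IsIntegral C]

/-! ## Dimension of the local rings -/

omit [IsIntegral C] in
/-- On a scheme of dimension `≤ 1` every local ring has dimension `≤ 1`. [folklore] -/
theorem ringKrullDim_stalk_le_one (hdim : topologicalKrullDim C ≤ 1) (y : C) :
    ringKrullDim (C.presheaf.stalk y) ≤ 1 := by
  rw [ringKrullDim_stalk_eq_coheight]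
  exact_mod_cast (topologicalKrullDim_le_iff_forall_coheight_le C 1).mp hdim y

/-- Every local ring of an integral scheme of dimension `≤ 1` is a field or one-dimensional.
[folklore] -/
theorem isField_or_ringKrullDim_eq_one (hdim : topologicalKrullDim C ≤ 1) (y : C) :
    IsField (C.presheaf.stalk y) ∨ ringKrullDim (C.presheaf.stalk y) = 1 := by
  by_cases hF : IsField (C.presheaf.stalk y)
  · exact Or.inl hF
  · right
    have hle := ringKrullDim_stalk_le_one hdim y
    have hpos : ¬ ringKrullDim (C.presheaf.stalk y) ≤ 0 := fun h => by
      haveI : Ring.KrullDimLE 0 (C.presheaf.stalk y) := Ring.krullDimLE_iff.mpr h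
      exact hF Ring.KrullDimLE.isField_of_isDomain
    exact le_antisymm hle (Order.succ_le_of_lt (lt_of_not_ge hpos))

/-! ## Finite normalization of the local rings -/

/-- The normalization of a field `F` in a fraction field `K` (`≅ F`) is module-finite. [folklore] -/
theorem module_finite_integralClosure_of_isField {F : Type u} [CommRing F] [IsDomain F]
    (hF : IsField F) (K : Type*) [Field K] [Algebra F K] [IsFractionRing F K] :
    Module.Finite F (integralClosure F K) := by
  -- `F → K` is bijective, so every element of `K` comes from `F`
  have hsurj : Function.Surjective (algebraMap F K) :=
    (hF.localization_map_bijective (M := nonZeroDivisors F) (Rₘ := K)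
      (zero_notMem_nonZeroDivisors)).2
  refine ⟨⟨{1}, ?_⟩⟩
  rw [eq_top_iff]
  rintro w -
  obtain ⟨r, hr⟩ := hsurj (w : K)
  rw [Finset.coe_singleton, Submodule.mem_span_singleton]
  exact ⟨r, Subtype.ext (by rw [← hr, Subalgebra.coe_smul, Algebra.smul_def]; simp)⟩

/-- **The local rings of an integral Noetherian quasi-excellent scheme of dimension `≤ 1` have
module-finite normalizations** (in the function field). [cite: Kollar2007, Thm. 1.101]
[cite: Matsumura1987, §32 p. 260] -/
theorem module_finite_integralClosure_stalk (hC : Scheme.IsQuasiExcellent C)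
    (hdim : topologicalKrullDim C ≤ 1) (y : C) :
    Module.Finite (C.presheaf.stalk y) (integralClosure (C.presheaf.stalk y) C.functionField) := by
  rcases isField_or_ringKrullDim_eq_one hdim y with hF | h1
  · exact module_finite_integralClosure_of_isField hF C.functionField
  · have hG : IsGRing (C.presheaf.stalk y) := (hC.isQuasiExcellentRing_stalk y).isGRing
    haveI := module_finite_integralClosure_of_isGRing_of_ringKrullDim_eq_one _ hG h1
    exact module_finite_integralClosure_of_isFractionRing C.functionField

/-! ## `δ` is finite, and zero at regular points -/

/-- `δ(y) < ∞` on an integral Noetherian quasi-excellent scheme of dimension `≤ 1`.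
[cite: Kollar2007, §1.4] -/
theorem pointDelta_ne_top (hC : Scheme.IsQuasiExcellent C) (hdim : topologicalKrullDim C ≤ 1)
    (y : C) : pointDelta C y ≠ ⊤ := by
  rcases isField_or_ringKrullDim_eq_one hdim y with hF | h1
  · letI := hF.toField
    have h0 : pointDelta C y = 0 :=
      (curveDelta_eq_zero_iff_isIntegrallyClosed (R := C.presheaf.stalk y) C.functionField).mpr
        inferInstance
    rw [h0]; exact ENat.zero_ne_top
  · haveI := module_finite_integralClosure_stalk hC hdim y
    haveI : IsNoetherianRing (C.presheaf.stalk y) := (hC.isQuasiExcellentRing_stalk y).isNoetherianRing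
    exact curveDelta_ne_top C.functionField h1

omit [IsIntegral C] in
/-- `δ(y) = 0` at a regular point of a scheme of dimension `≤ 1` (a regular local ring of
dimension `≤ 1` is a field or a discrete valuation ring, hence normal). [cite: Kollar2007, §1.4] -/
theorem pointDelta_eq_zero_of_isRegularLocalRing [IsIntegral C] (hdim : topologicalKrullDim C ≤ 1)
    (y : C) (hy : IsRegularLocalRing (C.presheaf.stalk y)) : pointDelta C y = 0 := by
  rcases isField_or_ringKrullDim_eq_one hdim y with hF | h1
  · letI := hF.toField
    exact (curveDelta_eq_zero_iff_isIntegrallyClosed (R := C.presheaf.stalk y) C.functionField).mpr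
      inferInstance
  · haveI := isDiscreteValuationRing_of_isRegularLocalRing_of_ringKrullDim_eq_one _ h1
    exact (curveDelta_eq_zero_iff_isIntegrallyClosed (R := C.presheaf.stalk y) C.functionField).mpr
      inferInstance

/-! ## The support of `δ` is finite -/

/-- **On an integral Noetherian quasi-excellent scheme of dimension `≤ 1` only finitely many
points have `δ ≠ 0`** — they are singular, and the singular locus is a proper closed subset of a
one-dimensional irreducible Noetherian space. [cite: Kollar2007, §1.4]
[cite: Matsumura1987, §32 p. 260] -/
theorem finite_support_pointDelta [IsNoetherian C] (hC : Scheme.IsQuasiExcellent C)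
    (hdim : topologicalKrullDim C ≤ 1) : (Function.support (pointDelta C)).Finite := by
  have hsub : Function.support (pointDelta C) ⊆ (Scheme.regularLocus C)ᶜ := fun y hy hreg =>
    hy (pointDelta_eq_zero_of_isRegularLocalRing hdim y hreg)
  have hclosed : IsClosed (Scheme.regularLocus C)ᶜ :=
    (Scheme.isOpen_regularLocus_of_isQuasiExcellent hC).isClosed_compl
  have hne : (Scheme.regularLocus C)ᶜ ≠ Set.univ := by
    intro h
    have hgen : genericPoint C ∈ Scheme.regularLocus C := genericPoint_mem_regularLocus C
    have : genericPoint C ∈ (Scheme.regularLocus C)ᶜ := h ▸ Set.mem_univ _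
    exact this hgen
  exact (Set.finite_and_isClosed_singleton_of_dim_le_one hdim hclosed hne).1.subset hsub

end Literature.AlgebraicGeometry.Resolution

end
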